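import Mathlib
import HarnessLib
import HarnessLib.Audit
import Summits.AtomisticToContinuum.Statement
import Literature.MathematicalPhysics.QuantumManyBody.PeriodicBoseGas

/-!
Route: BECBlockRotorRP

CLOSED (retired) 2026-08-15T13:38:41Z by operator:999:1257524 — reason: not-a-thesis: assembly does not conclude the sub-problem Statement — note: D-0027 §2.1 audit (human 2026-08-15: routes that do not decide the summit are removed): the assembly concludes `Literature.MathematicalPhysics.QuantumManyBody.BoseGas.BoseEinsteinCondensation`, not the sub-problem statement; a NEW conforming route may be opened from the same idea (generated `closes . The file is kept as the record of this route; refuted decls are indexed as negative knowledge (`ledger negatives`).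

BECBlockRotorRP (idea card integer-block-rotor-rp): REFLECTION POSITIVITY REGAINED AFTER BLOCKING.
It suffices to show, on the torus of side L = (N/rho)^{1/3} cut into K^3 blocks of healing-length
side l = L/K in [A rho^{-1/2}, 2A rho^{-1/2}]
(K even), the conjunction of
 (i)  BlockInfraredBound — for delta-near-minimisers Psi of the periodic N-body energy with INTEGER
block filling (K^3 | N), every
      non-zero block plane wave f_q(x) = L^{-3/2} exp(2 pi i q.floor(Kx/L)/K), q in Z^3, q != 0 mod
K, has occupation
      <f_q, gamma_Psi f_q> <= C / sqrt(eps(q)),  eps(q) = sum_j (1 - cos(2 pi q_j/K))   (the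
Kennedy-Lieb-Shastry T=0 shape, C = C(v, A));
 (ii) BlockCondensation — the block-constant modes u_B = l^{-3/2} 1_B carry sum_B <u_B, gamma_Psi
u_B> >= (1 - eta(rho)) N, eta -> 0;
 (iii) FillingRemainder — condensation along the commensurate family {N : K^3 | N for an admissible
even K} implies it for all large N;
 (iv) BoundaryTransferWeak (shared item of route BECPeriodicReduction) — periodic constant-mode BEC
implies the Dirichlet conjunct.
(i)+(ii) give, by Parseval over the K^3 block modes and the convergent lattice sum K^{-3} sum_{q !=
0} eps(q)^{-1/2} (d = 3), constant-mode
occupation >= (1 - eta - C I (rho a^3)^{1/2} A'^{-2}) N = IntegerFilledPeriodicBEC (support item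
BlockModeCounting); (iii) upgrades it to
PeriodicBEC (stmt-0826 body); (iv) gives HasGroundStateBEC, hence the conjunct.
The LINE for (i): Gaussian domination for the BLOCKED gas — the two-sided static susceptibility of
f_q in near-minimisers is <= C l^2/eps(q)
(item BlockSusceptibilityBound, rank 2) — obtained from the in-tree abstract ground-state
reflection-positivity lemma
Matrix.kls_groundEnergy_reflection applied to the integer-filled block number-phase (quantum-rotor /
Bose-Hubbard) form of the kinetic
inter-block coupling, where charge conjugation n_B -> 2m - n_B about the integer filling m is the
reflection that hard-core half filling
provided for ALSSY; then the canonical KLS transfer (double commutator + spectral Cauchy-Schwarz on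
the N-1 and N+1 sectors, support item
KLSTransfer) turns it into (i).
Lean (all decls elaborate, Sketch.lean rc 0; constants
Literature.MathematicalPhysics.QuantumManyBody.BoseGas.{IsRepulsiveFiniteRange,
PeriodicTrialState, periodicEnergy, periodicGroundStateEnergy, cellOccupation, condensateOccupation,
cell, cellN, sideLength,
HasGroundStateBEC, BoseEinsteinCondensation}):
Assembly := BlockModeCounting → BlockInfraredBound → BlockCondensation → FillingRemainder →
BoundaryTransferWeak →
Literature.MathematicalPhysics.QuantumManyBody.BoseGas.BoseEinsteinCondensation

Rationale: WHY THIS LINE. The only thermodynamic-limit proofs of interacting BEC are reflection-positivity (RP)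
+ infrared-bound proofs for lattice
bosons at a particle-hole symmetric point (AizenmanEtAl2004 = LSSY2005 Ch. 11; KLS1988PRL/KLS1988JSP
at T = 0, PROVED in tree:
kennedy_lieb_shastry_xy_ground_holds via the abstract GD lemma Matrix.kls_groundEnergy_reflection).
The continuum gas has no RP, but
Anderson/Fisher blocks (doi:10.1103/revmodphys.38.298, FisherEtAl1989) at INTEGER mean filling m
have a real number-phase Hamiltonian
(U n_B^2 - J cos(theta_B - theta_B'), J/U ~ (rho a^3)^{-1/2} at l ~ xi) which, after conjugating one
half-space by n_B -> 2m - n_B, is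
of the KLS real form A⊗1 + 1⊗A - Σ M_i⊗M_i (cos⊗cos + sin⊗sin -> cos⊗cos + D⊗D, D real) exactly at
integer (or half-integer) filling;
quantum-rotor RP/IR/LRO: DriesslerLandauPerez1979, PasturKhoruzhenko1987, Wojtkiewicz2012, review
BjornbergUeltschi2022. Imported: lattice
RP/Gaussian domination (stat. mech.) for the INFRARED half; LSSY/Fournais energy localisation
(PROVED in tree: LSSY2005_lowerBound_neumann_holds,
LSSY2005_upperBound_periodic_holds, LSSY2005_cellDecomposition_holds, LSSY2005_lemma41_holds,
LSSY2005_thm51_periodic_holds,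
Fournais2020_condensation_holds) for the ULTRAVIOLET half. They meet at ONE fixed block scale l ~ A
rho^{-1/2}.
RANKED CRUXES. (all typed; Sketch.lean rc 0)
 #2 BlockSusceptibilityBound — two-sided (N-1/N+1 sector) regularised static susceptibility of the
block wave f_q in near-minimisers
    <= C l^2/eps(q): phase rigidity = what Gaussian domination delivers (why it might fail: needs an
EXACT RP rewriting of the blocked gas;
    RP survives no perturbation, Speer1985; sources KLS1988JSP (17)-(25), FisherEtAl1989,
PasturKhoruzhenko1987).
 #3 BlockInfraredBound — KLS-shaped occupation bound n(f_q) <= C/sqrt(eps q), q != 0 mod K, at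
integer block filling; from #2 by the
    canonical KLS transfer or by any method (why it might fail: only if stiffness vanishes at the
healing scale; source KLS1988PRL eq (4)).
 #4 FillingRemainder — BEC along the commensurate family {K^3 | N} ⇒ all N (why it might fail: RP
states carry zero conjugation charge, so
    only N ≡ 0 mod K^3 is reached; residue ~ rho^{1/2}/A^3 of N is macroscopic and r·mu ≫ N/L^2
forbids energetic transfer; source
    HalfFillingReflectionPositivityNarrow rp_oddCharge_eq_zero,
EnergyAsymptoticsWithoutCondensation).
 #5 BlockCondensation — Σ_B n(u_B) >= (1-eta)N for near-minimisers of the big torus, eta(rho) -> 0,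
from Thm 2.2/2.4 + Lemma 4.1/5.2
    blockwise; first-order precision suffices at l ~ xi: depletion <= C(Y^{1/17} + (rho
a^3)^{1/3})(l/xi)^2 (why it might fail: per-block
    hypotheses of Thm 2.4 for under/over-filled blocks, hard cores; sources LSSY2005 Thm 2.4, Thm
5.1).
 #6 BoundaryTransferWeak — shared with route BECPeriodicReduction (stmt-AtomisticToContinuum-0827,
identical signature).
 #0 IntegerFilledPeriodicBEC [target]; #1 Assembly = modus ponens through the support item
BlockModeCounting.
KILL CRITERIA. A proof that near-minimisers at integer block filling violate
BlockSusceptibilityBound by a divergent factor at |q| ~ 1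
(phase susceptibility ≫ l^2, vanishing stiffness at the healing scale) kills #2, #3 and the route.
¬FillingRemainder with the rank-0 target
standing ⇒ pivot the target to BEC along the commensurate family + a grand-canonical/Dirichlet
transfer stated on that family.
¬BlockCondensation as typed ⇒ re-type window/quantifiers (no kill). ¬BoundaryTransferWeak kills
every periodic route, not only this one.
NOT DECOMPOSED YET. The exact RP rewriting of the blocked gas (Feshbach–Schur onto block-condensed
sectors n_B <= 2m with a
conjugation-even complement — the design problem inside #2); the KLS transfer internals beyond the
support item; Dirichlet transfer; T > 0;
grand-canonical variants; the RP-free alternative engine for #2 (GarbanSpencer2022, sibling card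
sync-instead-of-rp).
CHEAPEST FALSIFIER. Two-block test at Bogoliubov level: two Neumann boxes of side l = A rho^{-1/2}
coupled through a face; compute the exact
low-energy effective coupling between the block towers and check (a) that its cross-face part is
cos⊗cos + sin⊗sin in block phases with no
residual term that stays non-real after conjugating one side, (b) that the odd part of the block
charging energy about m is linear to the
precision l^2/eps needs. Either failing kills the RP mechanism of #2 (the typed statements survive
only as 'any method'). Cheaper still:
v ≡ 0 and the exactly-RP truncated rotor array must satisfy #2 with C ≈ 1/4 — a one-page check of
the typed normalisation.
SUPPORT. KLSTransfer (#2 ⇒ #3: smoothing block waves costs 1/s in the double commutator and s in the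
sum rule; sector reference energies
E0(N∓1) leave a concavity defect (2E0(N)-E0(N-1)-E0(N+1))_+ that must be <= c sqrt(rho/a) — trivial
for integrable v via the constant
one-particle trial state, Jastrow insertion for hard cores; the regulariser theta = eps(q)/l^2 costs
O(1) per mode ≪ n̄). BlockModeCounting
(Parseval on span{u_B}; K^{-3}Σ_{q≠0} eps(q)^{-1/2} bounded, cf. in-tree klsIntegral facts; an even
K with L/K in [A,2A]rho^{-1/2} exists
for large N; depletion into block waves <= C I (rho a^3)^{1/2}(xi/l)^2 N).
NUMBERS. Bogoliubov: n(f_q) ≈ c0 (l/xi)/sqrt(eps q), c0 = O(1), l/xi = A sqrt(a) constant in rho; n̄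
= rho l^3 = A^3 rho^{-1/2}; two-sided
susceptibility ≈ l^2/(4 eps(q)); block-wave depletion / N ≈ (rho a^3)^{1/2} (xi/l)^2 × K^{-3}Σ
eps^{-1/2}.
DEGENERATE CASES CHECKED. v ≡ 0: all items true (near-minimisers near-constant, E0 = 0). N prime:
target vacuous by design (#4 carries it).
periodicGroundStateEnergy = ⊤ only below close packing (excluded at small rho). q ≡ 0 mod K excluded
(f_0 = constantMode up to the cell).
SOURCES. LSSY2005 §1.2, Ch. 2, Ch. 5, Ch. 11; KLS1988PRL; KLS1988JSP; DysonLiebSimon1978;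
AizenmanEtAl2004; FisherEtAl1989;
DriesslerLandauPerez1979; PasturKhoruzhenko1987; Wojtkiewicz2012; BjornbergUeltschi2022;
Corgini2003; Speer1985; Fournais2020; Junge2026
(arXiv:2603.20776); ChongLiangNam2026 (arXiv:2510.20493); GarbanSpencer2022.

Novelty: NOVELTY (planner, 2026-08-15; searches run BEFORE this claim). Tools: `lit frontier
AtomisticToContinuum --since 2020` (BEC descendants:
Junge2026 = arXiv:2603.20776, ChongLiangNam2026 = arXiv:2510.20493, arXiv:2602.16566 dilute
Bose–Hubbard energy); `lit bridges --cross any`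
(no Bose-gas bridge); `lit search --source crossref` x4: "quantum rotor long-range order ground
state infrared bounds reflection positivity"
(Wojtkiewicz2012 doi:10.1016/j.physa.2012.06.028, BjornbergUeltschi2022 doi:10.4171/90-1/5),
"Bose-Hubbard reflection positivity integer
filling Gaussian domination long range order" (only physics phase-diagram papers; Corgini2003
doi:10.1007/978-3-0348-8018-3_5 'Gaussian
domination and BEC' — GD-based BEC for soluble/mean-field-type models, nearest title match, not
blocks of a continuum gas), "superfluid
stiffness lower bound dilute Bose gas rigorous infrared bound blocks" (nothing: Seiringer
free-energy bounds, SeiringerUeltschi Tc bound),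
"quantum rotors infrared bounds Pastur Khoruzhenko" (PasturKhoruzhenko1987 doi:10.1007/bf01022968,
BolinaParreira1998
doi:10.1142/s0217979298001630); local searchd was down (connection reset), OpenAlex HTTP 429, `lit
galaxy search --star all/pdf` x4 saturated
(queued > 90 s) — recorded in NOTES for a refuter re-run. Plus the two refuter audits already on the
card (audit-2, audit-14: crossref
"quantum rotor reflection positivity long range order", "integer filling Bose-Hubbard infrared bound
BEC proof": nothing regaining RP by
bl  [refs: 10.1016/j.physa.2012.06.028, 10.4171/90-1/5, 10.1007/978-3-0348-8018-3_5, 10.1007/bf01022968, 10.1142/s0217979298001630, 10.1103/physrevb.40.546, 10.1007/bf01011509, 10.1103/revmodphys.38.298, 2603.20776, 2510.20493, 2602.16566, doi:10.1016/j.physa.2012.06.028, doi:10.4171/90-1/5, doi:10.1007/978-3-0348-8018-3_5, doi:10.1007/bf01022968, doi:10.1142/s0217979298001630, doi:10.1103/physrevb.40.546, d]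

Barriers (technique_class: reflection-positivity infrared-bound block-localization): - technique_class: reflection-positivity infrared-bound block-localization
- Literature.Barriers.AtomisticToContinuum.HalfFillingReflectionPositivity: PARTLY evaded, PARTLY
inherited. Evaded: the reflection acts on BLOCK number–phase variables, Θ = (block
reflection)∘(charge conjugation n_B ↦ 2m − n_B about the integer block filling m), under which the
block charging energy is even and the inter-block hopping cos(θ_B − θ_B′) = cos⊗cos + sin⊗sin
becomes Σ C⊗C with real C — exactly the KLS real form that the PROVED in-tree lemma
Matrix.kls_groundEnergy_reflection needs; integer filling of soft, highly filled blocks replaces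
hard-core half filling, and blocking makes the filling a design parameter. Inherited: see the Narrow
entry (next line) — only total filling N ≡ 0 mod K^3 is reached; the residue is isolated as crux
FillingRemainder.
- Literature.Barriers.AtomisticToContinuum.HalfFillingReflectionPositivityNarrow: its proved
rigidity (hoppingRP_reflection_rigidity, rp_oddCharge_eq_zero: every state with real reflection form
has conjugation charge 0) APPLIES at block level and is NOT evaded: Gaussian domination holds only
in the charge-0 sector, i.e. N = K^3·m exactly (KLS's c_L, c_R live in that sector); since l = L/K
is quantised (K even) and N is given, the mechanism covers only the commensurate family and the
residue r < K^3 is a macroscopic fraction ~rho^{1/2}/A^3 of N; energy slack r·mu ≫ twist cost N/L^2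
forbids an energetic transfer (EnergyAsymptotics entry), so the ba

History (route lifecycle, newest last):
- 2026-08-15T13:38:41Z · CLOSED retired — not-a-thesis: assembly does not conclude the sub-problem Statement (operator:999:1257524)

sub-problem: BoseEinsteinCondensation · status: closed(retired) · opened planner-plancard-AtomisticToContinuum-BoseEin-e1ccbd64-0 2026-08-15T11:39:51Z · rev 0 · ledger route-AtomisticToContinuum-BECBlockRotorRP
GENERATED by the gate from the ledger (D-0016/17). Provers cite these decls: `theorem foo : Summit.AtomisticToContinuum.BoseEinsteinCondensation.Theses.BECBlockRotorRP.<Decl> := …` in Summits/AtomisticToContinuum/BoseEinsteinCondensation/Theorems/<Name>.lean.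
-/

namespace Summit.AtomisticToContinuum.BoseEinsteinCondensation.Theses.BECBlockRotorRP

open scoped BigOperators Topology Manifold Classical MeasureTheory ProbabilityTheory Matrix InnerProductSpace ComplexConjugate ContinuousMap
open Filter Set Function TopologicalSpace MeasureTheory

attribute [summit_statement] _root_.BoseEinsteinCondensation

/-- item stmt-AtomisticToContinuum-5094 · target · rank 0 · closed · moot by None · by planner
why it might fail: Inherits PeriodicBEC's openness on a sparse family; false only if torus near-minimisers fail to condense at commensurate N, i.e. if BEC itself fails.
sources: LSSY2005 Ch. 5 (5.1)-(5.2), Fournais2020 Thm 1.2, KLS1988PRL, stmt-AtomisticToContinuum-0826 (PeriodicBEC, implies it)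
[target] IntegerFilledPeriodicBEC — BEC ALONG THE COMMENSURATE FAMILY: for every repulsive
finite-range v there is a block-scale constant A > 0 and rho_0 > 0 such that for 0 < rho < rho_0
there is c > 0 with: for all large N ADMITTING an even K > 0 with K^3 | N and A rho^{-1/2} <= L/K <=
2A rho^{-1/2} (L = (N/rho)^{1/3}; integer block filling m = N/K^3 at healing-length block side),
there is delta > 0 such that every periodic delta-near-minimiser Psi on the torus of side L has
constant-mode occupation condensateOccupation N L Psi >= cN. Weaker than PeriodicBEC
(stmt-AtomisticToContinuum-0826), which implies it; vacuous at N with no admissible K (e.g. N prime)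
by design — crux FillingRemainder upgrades it. What the RP-after-blocking mechanism of card
integer-block-rotor-rp can reach. Sources: LSSY2005 Ch. 5; Fournais2020 Thm 1.2; KLS1988PRL. -/
@[route_item "route-AtomisticToContinuum-BECBlockRotorRP"]
def IntegerFilledPeriodicBEC : Prop :=
  ∀ v : ℝ → ENNReal, Literature.MathematicalPhysics.QuantumManyBody.BoseGas.IsRepulsiveFiniteRange v → ∃ A : ℝ, 0 < A ∧ ∃ ρ₀ : ℝ, 0 < ρ₀ ∧ ∀ ρ : ℝ, 0 < ρ → ρ < ρ₀ → ∃ c : ℝ, 0 < c ∧ ∀ᶠ N : ℕ in Filter.atTop, (∃ K : ℕ, Even K ∧ 0 < K ∧ K ^ 3 ∣ N ∧ A / Real.sqrt ρ ≤ (Literature.MathematicalPhysics.QuantumManyBody.BoseGas.sideLength ρ N) / (K : ℝ) ∧ (Literature.MathematicalPhysics.QuantumManyBody.BoseGas.sideLength ρ N) / (K : ℝ) ≤ 2 * A / Real.sqrt ρ) → ∃ δ : ENNReal, 0 < δ ∧ ∀ Ψ : Literature.MathematicalPhysics.QuantumManyBody.BoseGas.PeriodicTrialState N (Literature.MathematicalPhysics.QuantumManyBody.BoseGas.sideLength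 ρ N), Literature.MathematicalPhysics.QuantumManyBody.BoseGas.periodicEnergy v Ψ ≤ Literature.MathematicalPhysics.QuantumManyBody.BoseGas.periodicGroundStateEnergy v N (Literature.MathematicalPhysics.QuantumManyBody.BoseGas.sideLength ρ N) + δ → ENNReal.ofReal (c * N) ≤ Literature.MathematicalPhysics.QuantumManyBody.BoseGas.condensateOccupation N (Literature.MathematicalPhysics.QuantumManyBody.BoseGas.sideLength ρ N) Ψ.ψ

/-- item stmt-AtomisticToContinuum-5095 · crux · rank 2 · closed · moot by None · by planner
why it might fail: Needs EXACT Gaussian domination of the blocked gas: cross-face kinetic coupling is not of DLS bilinear form, n_B>2m tails and odd charging terms break conjugation symmetry, and RP survives no perturbation (Speer1985); minorants with extensive loss give no susceptibility bound.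
sources: KLS1988JSP eqs (17)-(25), DysonLiebSimon1978 Thm 4.2, FisherEtAl1989 = doi:10.1103/physrevb.40.546, PasturKhoruzhenko1987 = doi:10.1007/bf01022968, DriesslerLandauPerez1979 = doi:10.1007/bf01011509, Wojtkiewicz2012 = doi:10.1016/j.physa.2012.06.028
[crux] BlockSusceptibilityBound — GAUSSIAN DOMINATION FOR THE BLOCKED GAS (phase rigidity at the
healing scale; card integer-block-rotor-rp's inter-block engine). For v repulsive finite-range there
are rho_0, A, C > 0: for 0 < rho < rho_0, all large N, some delta > 0, every periodic
delta-near-minimiser Psi of the (N+1)-particle energy on the torus of side L = ((N+1)/rho)^{1/3},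
every even K > 0 with K^3 | N+1 and A rho^{-1/2} <= L/K <= 2A rho^{-1/2}, and every q in Z^3 with q
!= 0 mod K: b_-(q) + b_+(q) <= C (L/K)^2 / eps(q), eps(q) = sum_j (1 - cos(2 pi q_j/K)), where
b_-(q) = sup over N-particle periodic trial states Phi of |<Phi, a(f_q) Psi>|^2 / (E(Phi) - E_0(N) +
theta), b_+(q) = sup over (N+2)-particle Phi of |<a(f_q) Phi, Psi>|^2 / (E(Phi) - E_0(N+2) + theta),
a(f) the annihilation integral sqrt(M+1) ∫_cell conj(f(x)) Ψ(x, ·) dx, f_q(x) = L^{-3/2} exp(2 pi i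
q·floor(Kx/L)/K) the block plane wave, theta = eps(q)/(L/K)^2 a harmless regulariser. This is the
two-sided zero-temperature static susceptibility of the field a(f_q) + a(f_q)^*; Bogoliubov value ≈
l^2/(4 eps(q)). PROPOSED MECHANISM: exact reflection positivity of the blocked gas at integer block
filling m = (N+1)/K^3 — -/
@[route_item "route-AtomisticToContinuum-BECBlockRotorRP"]
def BlockSusceptibilityBound : Prop :=
  ∀ v : ℝ → ENNReal, Literature.MathematicalPhysics.QuantumManyBody.BoseGas.IsRepulsiveFiniteRange v → ∃ ρ₀ : ℝ, 0 < ρ₀ ∧ ∃ A : ℝ, 0 < A ∧ ∃ C : ℝ, 0 < C ∧ ∀ ρ : ℝ, 0 < ρ → ρ < ρ₀ → ∀ᶠ N : ℕ in Filter.atTop, ∃ δ : ENNReal, 0 < δ ∧ ∀ Ψ : Literature.MathematicalPhysics.QuantumManyBody.BoseGas.PeriodicTrialState (N + 1) (Literature.MathematicalPhysics.QuantumManyBody.BoseGas.sideLength ρ (N + 1)), Literature.MathematicalPhysics.QuantumManyBody.BoseGas.periodicEnergy v Ψ ≤ Literature.MathematicalPhysics.QuantumManyBody.BoseGas.periodicGroundStateEnergy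 v (N + 1) (Literature.MathematicalPhysics.QuantumManyBody.BoseGas.sideLength ρ (N + 1)) + δ → ∀ K : ℕ, Even K → 0 < K → K ^ 3 ∣ (N + 1) → A / Real.sqrt ρ ≤ (Literature.MathematicalPhysics.QuantumManyBody.BoseGas.sideLength ρ (N + 1)) / (K : ℝ) ∧ (Literature.MathematicalPhysics.QuantumManyBody.BoseGas.sideLength ρ (N + 1)) / (K : ℝ) ≤ 2 * A / Real.sqrt ρ → ∀ q : Fin 3 → ℤ, ¬ (∀ j : Fin 3, (K : ℤ) ∣ q j) → (⨆ Φ : Literature.MathematicalPhysics.QuantumManyBody.BoseGas.PeriodicTrialState N (Literature.MathematicalPhysics.QuantumManyBody.BoseGas.sideLength ρ (N + 1)), ENNReal.ofReal (‖((Real.sqrt ((N : ℝ) + 1) : ℝ) : ℂ) * ∫ Y in Literature.MathematicalPhysics.QuantumManyBody.BoseGas.cellN N (Literature.MathematicalPhysics.QuantumManyBody.BoseGas.sideLength ρ (N + 1)), (starRingEnd ℂ) (Φ.ψ Y) * (∫ x in Literature.MathematicalPhysics.QuantumManyBody.BoseGas.cell (Literature.MathematicalPhysics.QuantumManyBody.BoseGas.sideLength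 ρ (N + 1)), (starRingEnd ℂ) ((((Real.sqrt ((Literature.MathematicalPhysics.QuantumManyBody.BoseGas.sideLength ρ (N + 1)) ^ 3))⁻¹ : ℝ) : ℂ) * Complex.exp (((2 * Real.pi * (∑ j : Fin 3, (q j : ℝ) * (⌊(K : ℝ) * x j / (Literature.MathematicalPhysics.QuantumManyBody.BoseGas.sideLength ρ (N + 1))⌋ : ℝ)) / (K : ℝ) : ℝ) : ℂ) * Complex.I)) * Ψ.ψ (Matrix.vecCons x Y))‖ ^ 2) / (Literature.MathematicalPhysics.QuantumManyBody.BoseGas.periodicEnergy v Φ - Literature.MathematicalPhysics.QuantumManyBody.BoseGas.periodicGroundStateEnergy v N (Literature.MathematicalPhysics.QuantumManyBody.BoseGas.sideLength ρ (N + 1)) + ENNReal.ofReal ((∑ j : Fin 3, (1 - Real.cos (2 * Real.pi * (q j : ℝ) / (K : ℝ)))) / (((Literature.MathematicalPhysics.QuantumManyBody.BoseGas.sideLength ρ (N + 1)) / (K : ℝ)) ^ 2)))) + (⨆ Φ : Literature.MathematicalPhysics.QuantumManyBody.BoseGas.PeriodicTrialState (N + 2) (Literature.MathematicalPhysics.QuantumManyBody.BoseGas.sideLength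 ρ (N + 1)), ENNReal.ofReal (‖((Real.sqrt ((N : ℝ) + 2) : ℝ) : ℂ) * ∫ Y in Literature.MathematicalPhysics.QuantumManyBody.BoseGas.cellN (N + 1) (Literature.MathematicalPhysics.QuantumManyBody.BoseGas.sideLength ρ (N + 1)), (starRingEnd ℂ) (∫ x in Literature.MathematicalPhysics.QuantumManyBody.BoseGas.cell (Literature.MathematicalPhysics.QuantumManyBody.BoseGas.sideLength ρ (N + 1)), (starRingEnd ℂ) ((((Real.sqrt ((Literature.MathematicalPhysics.QuantumManyBody.BoseGas.sideLength ρ (N + 1)) ^ 3))⁻¹ : ℝ) : ℂ) * Complex.exp (((2 * Real.pi * (∑ j : Fin 3, (q j : ℝ) * (⌊(K : ℝ) * x j / (Literature.MathematicalPhysics.QuantumManyBody.BoseGas.sideLength ρ (N + 1))⌋ : ℝ)) / (K : ℝ) : ℝ) : ℂ) * Complex.I)) * Φ.ψ (Matrix.vecCons x Y)) * Ψ.ψ Y‖ ^ 2) / (Literature.MathematicalPhysics.QuantumManyBody.BoseGas.periodicEnergy v Φ - Literature.MathematicalPhysics.QuantumManyBody.BoseGas.periodicGroundStateEnergy v (N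 + 2) (Literature.MathematicalPhysics.QuantumManyBody.BoseGas.sideLength ρ (N + 1)) + ENNReal.ofReal ((∑ j : Fin 3, (1 - Real.cos (2 * Real.pi * (q j : ℝ) / (K : ℝ)))) / (((Literature.MathematicalPhysics.QuantumManyBody.BoseGas.sideLength ρ (N + 1)) / (K : ℝ)) ^ 2)))) ≤ ENNReal.ofReal (C * ((Literature.MathematicalPhysics.QuantumManyBody.BoseGas.sideLength ρ (N + 1)) / (K : ℝ)) ^ 2 / (∑ j : Fin 3, (1 - Real.cos (2 * Real.pi * (q j : ℝ) / (K : ℝ)))))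

/-- item stmt-AtomisticToContinuum-5096 · crux · rank 3 · closed · moot by None · by planner
why it might fail: False only if phase rigidity fails at the healing scale (block-wave susceptibility ≫ l²/ε(q): anomalously soft non-phonon branch); as typed, sharp block waves alias momenta 2π(q+Km)/L adding O(1), and C must be uniform in N, K, ρ<ρ₀ and for hard cores.
sources: KLS1988PRL eq (4), KLS1988JSP eqs (12)-(14), LSSY2005 Ch. 11 (11.22)-(11.27), Literature.MathematicalPhysics.QuantumLattice.kls_xy_infraredBound_ground_holds (in tree, proved), BjornbergUeltschi2022 = doi:10.4171/90-1/5, stmt-AtomisticToContinuum-0733 (sibling IR crux of route BECInfraredBound)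
[crux] BlockInfraredBound — T = 0 INFRARED BOUND FOR BLOCK PLANE WAVES (Kennedy-Lieb-Shastry shape).
For v repulsive finite-range there are rho_0, A, C > 0: for 0 < rho < rho_0, all large N, some delta
> 0, every periodic delta-near-minimiser Psi on the torus of side L = (N/rho)^{1/3}, every even K >
0 with K^3 | N (integer block filling) and A rho^{-1/2} <= L/K <= 2A rho^{-1/2} (healing-length
blocks), and every q in Z^3 with q != 0 mod K: the occupation of the block plane wave f_q(x) =
L^{-3/2} exp(2 pi i q·floor(Kx/L)/K) satisfies <f_q, gamma_Psi f_q> = cellOccupation N L f_q Psi <=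
C / sqrt(eps(q)), eps(q) = sum_j (1 - cos(2 pi q_j / K)). Bogoliubov predicts c_0
(l/xi)/sqrt(eps(q)) with l/xi = A sqrt(a) constant in rho, so C = C(v, A); only the K^3 coarse modes
(|p| <= pi/l ~ 1/xi, the LOW-momentum half) are constrained — the high-momentum half is
BlockCondensation. From BlockSusceptibilityBound by the canonical KLS transfer (support item
KLSTransfer: double commutator + spectral Cauchy-Schwarz on the N∓1 sectors), or by any method. Why
it might fail: only if phase rigidity fails at the healing scale (susceptibility ≫ l^2/eps(q), an
anomalously soft non-phonon branch); as typed -/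
@[route_item "route-AtomisticToContinuum-BECBlockRotorRP"]
def BlockInfraredBound : Prop :=
  ∀ v : ℝ → ENNReal, Literature.MathematicalPhysics.QuantumManyBody.BoseGas.IsRepulsiveFiniteRange v → ∃ ρ₀ : ℝ, 0 < ρ₀ ∧ ∃ A : ℝ, 0 < A ∧ ∃ C : ℝ, 0 < C ∧ ∀ ρ : ℝ, 0 < ρ → ρ < ρ₀ → ∀ᶠ N : ℕ in Filter.atTop, ∃ δ : ENNReal, 0 < δ ∧ ∀ Ψ : Literature.MathematicalPhysics.QuantumManyBody.BoseGas.PeriodicTrialState N (Literature.MathematicalPhysics.QuantumManyBody.BoseGas.sideLength ρ N), Literature.MathematicalPhysics.QuantumManyBody.BoseGas.periodicEnergy v Ψ ≤ Literature.MathematicalPhysics.QuantumManyBody.BoseGas.periodicGroundStateEnergy v N (Literature.MathematicalPhysics.QuantumManyBody.BoseGas.sideLength ρ N) + δ → ∀ K : ℕ, Even K → 0 < K → K ^ 3 ∣ N → A / Real.sqrt ρ ≤ (Literature.MathematicalPhysics.QuantumManyBody.BoseGas.sideLength ρ N) / (K : ℝ) ∧ (Literature.MathematicalPhysics.QuantumManyBody.BoseGas.sideLength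 ρ N) / (K : ℝ) ≤ 2 * A / Real.sqrt ρ → ∀ q : Fin 3 → ℤ, ¬ (∀ j : Fin 3, (K : ℤ) ∣ q j) → Literature.MathematicalPhysics.QuantumManyBody.BoseGas.cellOccupation N (Literature.MathematicalPhysics.QuantumManyBody.BoseGas.sideLength ρ N) (fun x : EuclideanSpace ℝ (Fin 3) => (((Real.sqrt ((Literature.MathematicalPhysics.QuantumManyBody.BoseGas.sideLength ρ N) ^ 3))⁻¹ : ℝ) : ℂ) * Complex.exp (((2 * Real.pi * (∑ j : Fin 3, (q j : ℝ) * (⌊(K : ℝ) * x j / (Literature.MathematicalPhysics.QuantumManyBody.BoseGas.sideLength ρ N)⌋ : ℝ)) / (K : ℝ) : ℝ) : ℂ) * Complex.I)) Ψ.ψ ≤ ENNReal.ofReal (C / Real.sqrt (∑ j : Fin 3, (1 - Real.cos (2 * Real.pi * (q j : ℝ) / (K : ℝ)))))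

/-- item stmt-AtomisticToContinuum-5097 · crux · rank 4 · closed · moot by None · by planner
why it might fail: RP reaches only N ≡ 0 mod K³; the residue is a macroscopic fraction ~ρ^{1/2}/A³ of N and near-minimiser classes do not transfer across N under slack r·μ ≫ N/L² (twisted states), so state-level continuity of BEC in N is needed — possibly as hard as BEC.
sources: Literature.Barriers.AtomisticToContinuum.HalfFillingReflectionPositivityNarrow (rp_oddCharge_eq_zero), Literature.Barriers.AtomisticToContinuum.EnergyAsymptoticsWithoutCondensation, LSSY2005 Ch. 11 §11.1 (closing paragraph: other fillings) and Ch. 5, idea cards AtomisticToContinuum/BoseEinsteinCondensation/one-particle-at-a-time, kv-insertion-corrector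
[crux] FillingRemainder — COMMENSURATE FAMILY ⇒ ALL N. For each repulsive finite-range v and each
block-scale constant A > 0: if periodic near-minimisers condense into the constant mode for all
large N admitting an even K > 0 with K^3 | N and A rho^{-1/2} <= L/K <= 2A rho^{-1/2} (the body of
IntegerFilledPeriodicBEC at this A), then PeriodicBEC(v) holds (the exact body of
stmt-AtomisticToContinuum-0826: all large N). Why it is a crux and not glue (new finding of this
route): reflection positivity after blocking reaches ONLY total filling N = K^3 m (every state with
real reflection form has zero conjugation charge — the proved rigidity rp_oddCharge_eq_zero of the
Narrow half-filling barrier, now at block level; KLS's c_L, c_R live in the charge-0 sector); l =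
L/K is quantised and N is given, the admissible family {K^3 m : m in [A^3 rho^{-1/2}, 8 A^3
rho^{-1/2}]} has gaps up to K^3 ~ N/m, a MACROSCOPIC fraction ~ rho^{1/2}/A^3 of N; tracing out r
particles scales gamma exactly ((N-r)/N) but leaves energy slack ~ r mu ≫ N/L^2 = cost of a phase
twist, so Delta-near-minimiser classes contain twisted, uncondensed states and no energetic transfer
exists. Needed: a state-level continuity o -/
@[route_item "route-AtomisticToContinuum-BECBlockRotorRP"]
def FillingRemainder : Prop :=
  ∀ v : ℝ → ENNReal, Literature.MathematicalPhysics.QuantumManyBody.BoseGas.IsRepulsiveFiniteRange v → ∀ A : ℝ, 0 < A → (∃ ρ₀ : ℝ, 0 < ρ₀ ∧ ∀ ρ : ℝ, 0 < ρ → ρ < ρ₀ → ∃ c : ℝ, 0 < c ∧ ∀ᶠ N : ℕ in Filter.atTop, (∃ K : ℕ, Even K ∧ 0 < K ∧ K ^ 3 ∣ N ∧ A / Real.sqrt ρ ≤ (Literature.MathematicalPhysics.QuantumManyBody.BoseGas.sideLength ρ N) / (K : ℝ) ∧ (Literature.MathematicalPhysics.QuantumManyBody.BoseGas.sideLength ρ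 N) / (K : ℝ) ≤ 2 * A / Real.sqrt ρ) → ∃ δ : ENNReal, 0 < δ ∧ ∀ Ψ : Literature.MathematicalPhysics.QuantumManyBody.BoseGas.PeriodicTrialState N (Literature.MathematicalPhysics.QuantumManyBody.BoseGas.sideLength ρ N), Literature.MathematicalPhysics.QuantumManyBody.BoseGas.periodicEnergy v Ψ ≤ Literature.MathematicalPhysics.QuantumManyBody.BoseGas.periodicGroundStateEnergy v N (Literature.MathematicalPhysics.QuantumManyBody.BoseGas.sideLength ρ N) + δ → ENNReal.ofReal (c * N) ≤ Literature.MathematicalPhysics.QuantumManyBody.BoseGas.condensateOccupation N (Literature.MathematicalPhysics.QuantumManyBody.BoseGas.sideLength ρ N) Ψ.ψ) → ∃ ρ₀ : ℝ, 0 < ρ₀ ∧ ∀ ρ : ℝ, 0 < ρ → ρ < ρ₀ → ∃ c : ℝ, 0 < c ∧ ∀ᶠ N : ℕ in Filter.atTop, ∃ δ : ENNReal, 0 < δ ∧ ∀ Ψ : Literature.MathematicalPhysics.QuantumManyBody.BoseGas.PeriodicTrialState N (Literature.MathematicalPhysics.QuantumManyBody.BoseGas.sideLength ρ N), Literature.MathematicalPhysics.QuantumManyBody.BoseGas.periodicEnergy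 v Ψ ≤ Literature.MathematicalPhysics.QuantumManyBody.BoseGas.periodicGroundStateEnergy v N (Literature.MathematicalPhysics.QuantumManyBody.BoseGas.sideLength ρ N) + δ → ENNReal.ofReal (c * N) ≤ Literature.MathematicalPhysics.QuantumManyBody.BoseGas.condensateOccupation N (Literature.MathematicalPhysics.QuantumManyBody.BoseGas.sideLength ρ N) Ψ.ψ

/-- item stmt-AtomisticToContinuum-5098 · crux · rank 5 · closed · moot by None · by planner
why it might fail: Thm 2.4's per-block hypotheses (Y_B<δ, l/a>C′Y_B^{-6/17}) fail for under/over-filled blocks (capping + monotonicity in n needed); δ must serve all K in the window; hard cores v=⊤; fixed-A window may need (ρa³)^{-η} room.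
sources: LSSY2005 Thm 2.2 (2.14), Thm 2.4 (2.35), Lemma 4.1, Lemma 5.2, Thm 5.1 (5.15)-(5.16), Literature.MathematicalPhysics.QuantumManyBody.BoseGas: LSSY2005_lowerBound_neumann_holds, LSSY2005_upperBound_periodic_holds, LSSY2005_cellDecomposition_holds, LSSY2005_lemma41_holds, LSSY2005_lemma52_periodic_holds, LSSY2005_thm51_periodic_holds (in tree, proved), Fournais2020 Thm 1.2 (Fournais2020_condensation_holds), Junge2026 = arXiv:2603.20776 Thm 3, ChongLiangNam2026 = arXiv:2510.20493 §4
[crux] BlockCondensation — INTRA-BLOCK BEC SUMMED OVER BLOCKS (the ultraviolet half; sum-rule side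
of the KLS argument). For v repulsive finite-range, every A > 0 and eta > 0 there is rho_0 > 0: for
0 < rho < rho_0, all large N, some delta > 0, every periodic delta-near-minimiser Psi on the torus
of side L = (N/rho)^{1/3} and every even K > 0 with A rho^{-1/2} <= L/K <= 2A rho^{-1/2}: sum over
blocks B in (Z/K)^3 of the occupation of the normalised block indicator u_B = (L/K)^{-3/2}
1_{floor(Kx/L) = B} is >= (1 - eta) N. (No integer-filling hypothesis.) Route to proof, all inputs
PROVED in tree: Neumann localisation of the torus into K^3 blocks (kinetic form splits, v >= 0 drops
cross-block pairs; LSSY2005_cellDecomposition_holds pattern), per-block lower bound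
LSSY2005_lowerBound_neumann_holds (Thm 2.4) with the capping argument for under/over-filled blocks
(monotonicity of E^Neu in n), global upper bound LSSY2005_upperBound_periodic_holds (Thm 2.2),
Jensen on Σ_B n_B^2, and the gap step of LSSY Thm 5.1 / Lemma 5.2 inside each block
(LSSY2005_lemma41_holds, LSSY2005_lemma52_periodic_holds, LSSY2005_thm51_periodic_holds);
first-order energy precision suffices because the block is a -/
@[route_item "route-AtomisticToContinuum-BECBlockRotorRP"]
def BlockCondensation : Prop :=
  ∀ v : ℝ → ENNReal, Literature.MathematicalPhysics.QuantumManyBody.BoseGas.IsRepulsiveFiniteRange v → ∀ A : ℝ, 0 < A → ∀ η : ℝ, 0 < η → ∃ ρ₀ : ℝ, 0 < ρ₀ ∧ ∀ ρ : ℝ, 0 < ρ → ρ < ρ₀ → ∀ᶠ N : ℕ in Filter.atTop, ∃ δ : ENNReal, 0 < δ ∧ ∀ Ψ : Literature.MathematicalPhysics.QuantumManyBody.BoseGas.PeriodicTrialState N (Literature.MathematicalPhysics.QuantumManyBody.BoseGas.sideLength ρ N), Literature.MathematicalPhysics.QuantumManyBody.BoseGas.periodicEnergy v Ψ ≤ Literature.MathematicalPhysics.QuantumManyBody.BoseGas.periodicGroundStateEnergy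 v N (Literature.MathematicalPhysics.QuantumManyBody.BoseGas.sideLength ρ N) + δ → ∀ K : ℕ, Even K → 0 < K → A / Real.sqrt ρ ≤ (Literature.MathematicalPhysics.QuantumManyBody.BoseGas.sideLength ρ N) / (K : ℝ) ∧ (Literature.MathematicalPhysics.QuantumManyBody.BoseGas.sideLength ρ N) / (K : ℝ) ≤ 2 * A / Real.sqrt ρ → ENNReal.ofReal ((1 - η) * N) ≤ ∑ B : Fin 3 → Fin K, Literature.MathematicalPhysics.QuantumManyBody.BoseGas.cellOccupation N (Literature.MathematicalPhysics.QuantumManyBody.BoseGas.sideLength ρ N) (fun x : EuclideanSpace ℝ (Fin 3) => if (∀ j : Fin 3, ⌊(K : ℝ) * x j / (Literature.MathematicalPhysics.QuantumManyBody.BoseGas.sideLength ρ N)⌋ = (((B j : Fin K) : ℕ) : ℤ)) then ((((Real.sqrt (((Literature.MathematicalPhysics.QuantumManyBody.BoseGas.sideLength ρ N) / (K : ℝ)) ^ 3))⁻¹ : ℝ) : ℂ)) else 0) Ψ.ψ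

/-- item stmt-AtomisticToContinuum-0827 · crux · rank 6 · open · by planner
why it might fail: PeriodicBEC(v) is ground-state-only (δ after N) at the box (N/ρ)^{1/3}: the Dirichlet GS is a periodic trial state but lies a wall term ≫δ above E₀^per; interior restrictions are neither periodic nor of sharp N, so the hypothesis may never fire (transfer≈conjunct). BEC is BC-sensitive: Robinson1976.
sources: LiebSeiringerSolovejYngvason2005 Ch.2 after (2.2) and after (2.8); Thm 5.1 remark p.36, Basti2022 = arXiv:2203.01841 p.3, BoccatoSeiringer2023 = arXiv:2205.15284 pp.1-2, Junge2026 = arXiv:2603.20776 Thm 3, Robinson1976 = doi:10.1007/bf01608554, stmt-AtomisticToContinuum-0827 (home: route-AtomisticToContinuum-BECPeriodicReduction)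
[crux] BoundaryTransferWeak (mode-free boundary-condition transfer, per potential): for each
repulsive finite-range v, PeriodicBEC(v) implies ∃ρ₀>0 ∀ρ∈(0,ρ₀) HasGroundStateBEC v ρ (Dirichlet
ground state, λ_max(γ) ≥ cN via condensateNumber). Not glue: near-minimiser slacks are O(N/L²) while
Dirichlet/periodic energies differ by a boundary term ≫ N/L², so no energy-comparison proof;
expected route: Neumann bracketing of interior sub-boxes (−Δ_Dir ≥ ⊕−Δ_Neu, v ≥ 0) + a mode-free
criterion (λ_max ≥ tr γ²/N). Only the ENERGY analogue is in print (LiebSeiringerSolovejYngvason2005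
Ch. 2 after (2.8)). v ≡ 0: hypothesis and conclusion both true. -/
@[route_item "route-AtomisticToContinuum-BECBlockRotorRP"]
def BoundaryTransferWeak : Prop :=
  ∀ v : ℝ → ENNReal, Literature.MathematicalPhysics.QuantumManyBody.BoseGas.IsRepulsiveFiniteRange v → (∃ ρ₀ : ℝ, 0 < ρ₀ ∧ ∀ ρ : ℝ, 0 < ρ → ρ < ρ₀ → ∃ c : ℝ, 0 < c ∧ ∀ᶠ N : ℕ in Filter.atTop, ∃ δ : ENNReal, 0 < δ ∧ ∀ Ψ : Literature.MathematicalPhysics.QuantumManyBody.BoseGas.PeriodicTrialState N (Literature.MathematicalPhysics.QuantumManyBody.BoseGas.sideLength ρ N), Literature.MathematicalPhysics.QuantumManyBody.BoseGas.periodicEnergy v Ψ ≤ Literature.MathematicalPhysics.QuantumManyBody.BoseGas.periodicGroundStateEnergy v N (Literature.MathematicalPhysics.QuantumManyBody.BoseGas.sideLength ρ N) + δ → ENNReal.ofReal (c * N) ≤ Literature.MathematicalPhysics.QuantumManyBody.BoseGas.condensateOccupation N (Literature.MathematicalPhysics.QuantumManyBody.BoseGas.sideLength ρ N) Ψ.ψ)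 → ∃ ρ₀ : ℝ, 0 < ρ₀ ∧ ∀ ρ : ℝ, 0 < ρ → ρ < ρ₀ → Literature.MathematicalPhysics.QuantumManyBody.BoseGas.HasGroundStateBEC v ρ

/-- item stmt-AtomisticToContinuum-5099 · support · rank 9 · closed · moot by None · by planner
[support] KLSTransfer — BlockSusceptibilityBound → BlockInfraredBound: the canonical (fixed-N)
Kennedy-Lieb-Shastry transfer. For u = a(f_q)Ψ ∈ H_{N-1}, w = a(f_q)^*Ψ ∈ H_{N+1}: 2n(f_q)+1 =
‖u‖²+‖w‖² ≤ sqrt((b_- + b_+)(c_- + c_+)) by spectral Cauchy-Schwarz with SECTOR-WISE reference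
energies E₀(N∓1) (no convexity of E₀(N) needed for positivity), where c_- + c_+ =
⟨[a(f)^*,[H,a(f)]]⟩ + μ_- n − μ_+(n+1) ≤ D_q + κ₊ n with D_q = ⟨f,−Δf⟩ + interaction double
commutator = O(eps(q)/l² + μ) for s-SMOOTHED block waves (sharp indicators have ⟨f,−Δf⟩ = ∞: smooth
at relative scale s, losing 1/s here and O(s) in the sum rule) and κ₊ = (2E₀(N) − E₀(N−1) −
E₀(N+1))₊ the concavity defect, which must be ≤ c·sqrt(rho/a) — trivially true for integrable v
(E₀(N) ≤ E₀(N−1) + rho‖v‖₁ by the constant one-particle trial function and bosonic = absolute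
ground-state energy; monotonicity gives E₀(N+1) ≥ E₀(N)), Jastrow insertion for hard cores; the
regulariser theta = eps(q)/l² adds ≤ C per mode ≪ n̄ = rho l³. Output n(f_q) ≤ C′(l/xi)/sqrt(eps q)
+ O(1). Ψ a δ-near-minimiser rather than an eigenvector: the commutator identities hold up to
O(δ^{1/2}) terms, δ chosen last. Sources: KLS1988JSP (12)-(14), (19); -/
@[route_item "route-AtomisticToContinuum-BECBlockRotorRP"]
def KLSTransfer : Prop :=
  BlockSusceptibilityBound → BlockInfraredBound

/-- item stmt-AtomisticToContinuum-5100 · support · rank 9 · closed · moot by None · by planner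
[support] BlockModeCounting — BlockInfraredBound → BlockCondensation → IntegerFilledPeriodicBEC
(mode counting, the d = 3 step). With A, C from the infrared bound and eta = 1/4 in
BlockCondensation: (i) Parseval on the K^3-dimensional span of the block indicators: Σ_{q ∈ (Z/K)^3}
n(f_q) = Σ_B n(u_B) (finite Fourier transform on (Z/K)^3; occupation as a quadratic form, Fubini);
(ii) f_0 = constantMode L on the cell, so n(f_0) = condensateOccupation; (iii) Σ_{q≠0} n(f_q) ≤ C
K^3 · I_K with I_K = K^{-3} Σ_{q≠0} eps(q)^{-1/2} ≤ I < ∞ uniformly in K (Riemann sum of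
∫_{[-π,π]^3} dq/(2π)^3 eps(q)^{-1/2}; cf. in-tree klsIntegral facts for 1/eps); (iv) N = n̄ K^3 with
n̄ = rho (L/K)^3 ≥ A^3 rho^{-1/2}, so Σ_{q≠0} n(f_q) ≤ (C I A^{-3} rho^{1/2}) N ≤ N/4 for rho small;
hence n(f_0) ≥ N/2: c = 1/2 after shrinking rho_0; (v) for all large N an even K with L/K ∈ [A, 2A]
rho^{-1/2} exists (interval of length ≥ 2), and the target's hypothesis supplies one with K^3 | N;
(vi) ENNReal bookkeeping (ofReal, tsub). Sources: KLS1988PRL (sum rule + (4) ⇒ LRO); LSSY2005 Ch. 11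
(11.22)-(11.27); in tree xy_structureFactor_sumRule_holds, klsIntegral_le_two_holds. -/
@[route_item "route-AtomisticToContinuum-BECBlockRotorRP"]
def BlockModeCounting : Prop :=
  BlockInfraredBound → BlockCondensation → IntegerFilledPeriodicBEC

/-- item stmt-AtomisticToContinuum-5101 · assembly · rank 1 · closed · moot by None · by planner
[assembly] BlockModeCounting → BlockInfraredBound → BlockCondensation → FillingRemainder →
BoundaryTransferWeak → BoseEinsteinCondensation. Pure modus ponens (checked in Sketch.lean): intro
hmc h1 h2 h3 h4 v hv; obtain ⟨A, hA, hifp⟩ := hmc h1 h2 v hv; exact h4 v hv (h3 v hv A hA hifp). -/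
@[route_item "route-AtomisticToContinuum-BECBlockRotorRP"]
def Assembly : Prop :=
  BlockModeCounting → BlockInfraredBound → BlockCondensation → FillingRemainder → BoundaryTransferWeak → Literature.MathematicalPhysics.QuantumManyBody.BoseGas.BoseEinsteinCondensation

end Summit.AtomisticToContinuum.BoseEinsteinCondensation.Theses.BECBlockRotorRP
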